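import Mathlib

/-!
# Every residual class after D8 has an anisotropic norm space — the general descent, with the representative as a parameter
(P2-ResidualClassesAnisotropy v1 Theorem 1(b); companion of AnisotropicResidualClasses.lean (p408641, the first members);
seat p2 (g2), pub-hodge-repro0)

For `K = K⁺(i)`, `K⁺ = ℚ(√d)`, `d ∈ {3, 2}`, and `c = c₀ + c₁√d ∈ K⁺`, the norm space `Q_c(x) = Tr_{K⁺/ℚ}(c x x̄)` on `K` is
`q_c ⊥ q_c` with `q_c(a₀ + a₁√d) = 2c₀a₀² + 2dc₀a₁² + 4dc₁a₀a₁` (`trace_form` below, a ring identity); so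
`Q_c/2 = c₀(a₀² + b₀²) + d c₀(a₁² + b₁²) + 2 d c₁(a₀a₁ + b₀b₁)`.
* `d = 3` (`ℚ(ζ₁₂)`): if `3 ∤ c₀` then `Q_c` has no non-zero integer zero (`anisotropic_three`: 3-adic descent — the form is
  `≡ c₀(a₀² + b₀²) (mod 3)`, then `≡ 3c₀(a₁² + b₁²) (mod 9)`, and it is homogeneous). Every residual class `{v₋} ∪ S`
  (`S` the primes above `p₁, …, p_r ≡ 11 (mod 12)`) has a representative with `N(c) = c₀² − 3c₁² = −p₁⋯p_r`, and then
  `3 ∤ c₀` (`norm_cond_three`).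
* `d = 2` (`ℚ(ζ₈)`): if `c₀` is odd and `c₁` even then `Q_c` has no non-zero integer zero (`anisotropic_two`: 2-adic descent —
  `x, y` of the same parity; both odd would give `c₀·2 + 2c₀(u² + v²) ≡ 0 (mod 8)`, i.e. `u² + v² ≡ 3 (mod 4)`). Every residual
  class (`p_i ≡ 7 (mod 8)`) has a representative with `N(c) = c₀² − 2c₁² = −P ≡ 1 (mod 8)`, which forces `c₀` odd and `c₁` even
  (`norm_cond_two`).
Together with the Hilbert-symbol computation of the note (which also gives anisotropy at the `p_i`), this certifies by descent the
anisotropy at `3` resp. `2` for EVERY residual class of either field, not only for `1 + 2√3` and `1 + 2√2`.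
-/

namespace HodgeRepro0.AnisotropicResidualGeneral

/-- `ℤ[√d]` as pairs `(r, s) = r + s√d`: multiplication -/
def mulD (d : ℤ) (x y : ℤ × ℤ) : ℤ × ℤ := (x.1 * y.1 + d * x.2 * y.2, x.1 * y.2 + x.2 * y.1)

/-- the trace `Tr_{K⁺/ℚ}(r + s√d) = 2r` -/
def tr (x : ℤ × ℤ) : ℤ := 2 * x.1

/-- `Tr_{K⁺/ℚ}((c₀ + c₁√d)(a₀ + a₁√d)²) = 2c₀a₀² + 2dc₀a₁² + 4dc₁a₀a₁` -/
theorem trace_form (d c0 c1 a0 a1 : ℤ) :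
    tr (mulD d (c0, c1) (mulD d (a0, a1) (a0, a1))) = 2 * c0 * a0 ^ 2 + 2 * d * c0 * a1 ^ 2 + 4 * d * c1 * a0 * a1 := by
  simp only [mulD, tr]; ring

/-- `Q_c / 2` for `K⁺ = ℚ(√3)`: `c₀(a₀² + b₀²) + 3c₀(a₁² + b₁²) + 6c₁(a₀a₁ + b₀b₁)` -/
def q3 (c0 c1 a0 a1 b0 b1 : ℤ) : ℤ :=
  c0 * (a0 ^ 2 + b0 ^ 2) + 3 * c0 * (a1 ^ 2 + b1 ^ 2) + 6 * c1 * (a0 * a1 + b0 * b1)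

/-- `Q_c / 2` for `K⁺ = ℚ(√2)`: `c₀(a₀² + b₀²) + 2c₀(a₁² + b₁²) + 4c₁(a₀a₁ + b₀b₁)` -/
def q2 (c0 c1 a0 a1 b0 b1 : ℤ) : ℤ :=
  c0 * (a0 ^ 2 + b0 ^ 2) + 2 * c0 * (a1 ^ 2 + b1 ^ 2) + 4 * c1 * (a0 * a1 + b0 * b1)

/-- `Q_c = 2 q3` on `x = a₀ + a₁√3 + i(b₀ + b₁√3)` -/
theorem Q_eq_two_q3 (c0 c1 a0 a1 b0 b1 : ℤ) :
    tr (mulD 3 (c0, c1) (mulD 3 (a0, a1) (a0, a1))) + tr (mulD 3 (c0, c1) (mulD 3 (b0, b1) (b0, b1)))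
      = 2 * q3 c0 c1 a0 a1 b0 b1 := by
  simp only [mulD, tr, q3]; ring

/-- `Q_c = 2 q2` on `x = a₀ + a₁√2 + i(b₀ + b₁√2)` -/
theorem Q_eq_two_q2 (c0 c1 a0 a1 b0 b1 : ℤ) :
    tr (mulD 2 (c0, c1) (mulD 2 (a0, a1) (a0, a1))) + tr (mulD 2 (c0, c1) (mulD 2 (b0, b1) (b0, b1)))
      = 2 * q2 c0 c1 a0 a1 b0 b1 := by
  simp only [mulD, tr, q2]; ring

/-- a square is `0` or `1` modulo `3` -/
lemma sq_emod_three (x : ℤ) : x ^ 2 % 3 = 0 ∨ x ^ 2 % 3 = 1 := by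
  have h0 : 0 ≤ x % 3 := Int.emod_nonneg x (by norm_num)
  have h3 : x % 3 < 3 := Int.emod_lt_of_pos x (by norm_num)
  have : x ^ 2 % 3 = (x % 3) * (x % 3) % 3 := by rw [pow_two, Int.mul_emod]
  rw [this]
  interval_cases (x % 3) <;> simp

/-- if `3 ∤ c` and `3 ∣ c(b² + u²)` then `3 ∣ b` and `3 ∣ u` -/
lemma three_dvd_of_sq_add_sq {c b u : ℤ} (hc : c % 3 ≠ 0) (h : (3 : ℤ) ∣ c * (b ^ 2 + u ^ 2)) :
    3 ∣ b ∧ 3 ∣ u := by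
  have hb := sq_emod_three b
  have hu := sq_emod_three u
  have hprod : (c * (b ^ 2 + u ^ 2)) % 3 = 0 := Int.emod_eq_zero_of_dvd h
  have hmul : (c * (b ^ 2 + u ^ 2)) % 3 = ((c % 3) * ((b ^ 2 + u ^ 2) % 3)) % 3 := Int.mul_emod _ _ _
  have hadd : (b ^ 2 + u ^ 2) % 3 = ((b ^ 2 % 3) + (u ^ 2 % 3)) % 3 := Int.add_emod _ _ _
  have hc0 : 0 ≤ c % 3 := Int.emod_nonneg c (by norm_num)
  have hc3 : c % 3 < 3 := Int.emod_lt_of_pos c (by norm_num)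
  have hb0 : b ^ 2 % 3 = 0 := by
    rcases hb with hb | hb <;> rcases hu with hu | hu <;> interval_cases (c % 3) <;> simp_all
  have hu0 : u ^ 2 % 3 = 0 := by
    rcases hb with hb | hb <;> rcases hu with hu | hu <;> interval_cases (c % 3) <;> simp_all
  exact ⟨Int.prime_three.dvd_of_dvd_pow (Int.dvd_of_emod_eq_zero hb0),
         Int.prime_three.dvd_of_dvd_pow (Int.dvd_of_emod_eq_zero hu0)⟩

/-- `q3(3a₀, 3a₁, 3b₀, 3b₁) = 9 q3(a₀, a₁, b₀, b₁)` -/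
lemma q3_three_mul (c0 c1 a0 a1 b0 b1 : ℤ) :
    q3 c0 c1 (3 * a0) (3 * a1) (3 * b0) (3 * b1) = 9 * q3 c0 c1 a0 a1 b0 b1 := by
  unfold q3; ring

/-- `q3 ≡ c₀(a₀² + b₀²) (mod 3)` -/
lemma q3_mod_three (c0 c1 a0 a1 b0 b1 : ℤ) :
    q3 c0 c1 a0 a1 b0 b1 - c0 * (a0 ^ 2 + b0 ^ 2) = 3 * (c0 * (a1 ^ 2 + b1 ^ 2) + 2 * c1 * (a0 * a1 + b0 * b1)) := by
  unfold q3; ring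

/-- `q3(3a, a₁, 3b, b₁) = 3 c₀(a₁² + b₁²) + 9(…)` -/
lemma q3_shift (c0 c1 a a1 b b1 : ℤ) :
    q3 c0 c1 (3 * a) a1 (3 * b) b1
      = 3 * (c0 * (a1 ^ 2 + b1 ^ 2)) + 9 * (c0 * (a ^ 2 + b ^ 2) + 2 * c1 * (a * a1 + b * b1)) := by
  unfold q3; ring

/-- 3-adic descent for `q3` when `3 ∤ c₀` -/
lemma descent3 (c0 c1 : ℤ) (hc : c0 % 3 ≠ 0) (n : ℕ) :
    ∀ a0 a1 b0 b1 : ℤ, a0.natAbs + a1.natAbs + b0.natAbs + b1.natAbs ≤ n →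
      q3 c0 c1 a0 a1 b0 b1 = 0 → a0 = 0 ∧ a1 = 0 ∧ b0 = 0 ∧ b1 = 0 := by
  induction n with
  | zero =>
    intro a0 a1 b0 b1 hn _
    have h0 : a0.natAbs = 0 := by omega
    have h1 : a1.natAbs = 0 := by omega
    have h2 : b0.natAbs = 0 := by omega
    have h3 : b1.natAbs = 0 := by omega
    exact ⟨Int.natAbs_eq_zero.mp h0, Int.natAbs_eq_zero.mp h1, Int.natAbs_eq_zero.mp h2, Int.natAbs_eq_zero.mp h3⟩
  | succ n ih =>
    intro a0 a1 b0 b1 hn h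
    have h1 : (3 : ℤ) ∣ c0 * (a0 ^ 2 + b0 ^ 2) := by
      refine ⟨-(c0 * (a1 ^ 2 + b1 ^ 2) + 2 * c1 * (a0 * a1 + b0 * b1)), ?_⟩
      have := q3_mod_three c0 c1 a0 a1 b0 b1
      linarith
    obtain ⟨⟨a, rfl⟩, ⟨b, rfl⟩⟩ := three_dvd_of_sq_add_sq hc h1
    have h2 : (3 : ℤ) ∣ c0 * (a1 ^ 2 + b1 ^ 2) := by
      refine ⟨-(c0 * (a ^ 2 + b ^ 2) + 2 * c1 * (a * a1 + b * b1)), ?_⟩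
      have := q3_shift c0 c1 a a1 b b1
      linarith
    obtain ⟨⟨a', rfl⟩, ⟨b', rfl⟩⟩ := three_dvd_of_sq_add_sq hc h2
    rw [q3_three_mul] at h
    have h' : q3 c0 c1 a a' b b' = 0 := by omega
    have hsize : a.natAbs + a'.natAbs + b.natAbs + b'.natAbs ≤ n := by
      rw [Int.natAbs_mul, Int.natAbs_mul, Int.natAbs_mul, Int.natAbs_mul] at hn
      simp only [Int.reduceAbs] at hn
      omega
    obtain ⟨ha, ha', hb, hb'⟩ := ih a a' b b' hsize h'
    subst ha ha' hb hb'
    exact ⟨by ring, by ring, by ring, by ring⟩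

/-- for `K = ℚ(ζ₁₂)`: if `3 ∤ c₀`, the norm space of `c = c₀ + c₁√3` has no non-zero integer zero -/
theorem anisotropic_three (c0 c1 : ℤ) (hc : c0 % 3 ≠ 0) (a0 a1 b0 b1 : ℤ)
    (h : q3 c0 c1 a0 a1 b0 b1 = 0) : a0 = 0 ∧ a1 = 0 ∧ b0 = 0 ∧ b1 = 0 :=
  descent3 c0 c1 hc _ a0 a1 b0 b1 le_rfl h

/-- a representative of norm `−P` with `3 ∤ P` has `3 ∤ c₀` -/
theorem norm_cond_three (c0 c1 P : ℤ) (hN : c0 ^ 2 - 3 * c1 ^ 2 = -P) (hP : P % 3 ≠ 0) : c0 % 3 ≠ 0 := by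
  intro h0
  obtain ⟨k, hk⟩ := Int.dvd_of_emod_eq_zero h0
  apply hP
  subst hk
  have e : (3 * k) ^ 2 = 9 * k ^ 2 := by ring
  rw [e] at hN
  omega

/-- a square modulo `8` is `0`, `1` or `4`, and it is `1` exactly for odd arguments -/
lemma sq_emod_eight (x : ℤ) :
    (x % 2 = 0 ∧ (x ^ 2 % 8 = 0 ∨ x ^ 2 % 8 = 4)) ∨ (x % 2 = 1 ∧ x ^ 2 % 8 = 1) := by
  have h0 : 0 ≤ x % 8 := Int.emod_nonneg x (by norm_num)
  have h8 : x % 8 < 8 := Int.emod_lt_of_pos x (by norm_num)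
  have hsq : x ^ 2 % 8 = (x % 8) * (x % 8) % 8 := by rw [pow_two, Int.mul_emod]
  have hpar : x % 2 = (x % 8) % 2 := by omega
  rw [hsq, hpar]
  interval_cases (x % 8) <;> simp

/-- a square is `0` or `1` modulo `4` -/
lemma sq_emod_four (x : ℤ) : x ^ 2 % 4 = 0 ∨ x ^ 2 % 4 = 1 := by
  have h0 : 0 ≤ x % 4 := Int.emod_nonneg x (by norm_num)
  have h4 : x % 4 < 4 := Int.emod_lt_of_pos x (by norm_num)
  have : x ^ 2 % 4 = (x % 4) * (x % 4) % 4 := by rw [pow_two, Int.mul_emod]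
  rw [this]
  interval_cases (x % 4) <;> simp

/-- `x² + y² + 2u² + 2v² + 8w = 0` forces `x` and `y` even (the `c₀ = 1` case) -/
lemma even_even_base {x y u v w : ℤ} (h : x ^ 2 + y ^ 2 + 2 * u ^ 2 + 2 * v ^ 2 + 8 * w = 0) :
    2 ∣ x ∧ 2 ∣ y := by
  have hx := sq_emod_eight x
  have hy := sq_emod_eight y
  have hu := sq_emod_four u
  have hv := sq_emod_four v
  have hx2 : x % 2 = 0 := by omega
  have hy2 : y % 2 = 0 := by omega
  exact ⟨Int.dvd_of_emod_eq_zero hx2, Int.dvd_of_emod_eq_zero hy2⟩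

/-- an odd square is `1` modulo `8`: `c₀ odd ⇒ c₀² = 8t + 1` -/
lemma odd_sq_eq {c0 : ℤ} (hc : c0 % 2 = 1) : ∃ t : ℤ, c0 ^ 2 = 8 * t + 1 := by
  have h := sq_emod_eight c0
  have h8 : c0 ^ 2 % 8 = 1 := by omega
  exact ⟨c0 ^ 2 / 8, by omega⟩

/-- for `c₀` odd: `c₀(x² + y²) + 2c₀(u² + v²) + 8w = 0` forces `x` and `y` even (multiply by `c₀` and use `c₀² = 8t + 1`) -/
lemma even_even_of_eq {c0 x y u v w : ℤ} (hc : c0 % 2 = 1)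
    (h : c0 * (x ^ 2 + y ^ 2) + 2 * c0 * (u ^ 2 + v ^ 2) + 8 * w = 0) : 2 ∣ x ∧ 2 ∣ y := by
  obtain ⟨t, ht⟩ := odd_sq_eq hc
  have h' : x ^ 2 + y ^ 2 + 2 * u ^ 2 + 2 * v ^ 2 + 8 * (t * (x ^ 2 + y ^ 2) + 2 * t * (u ^ 2 + v ^ 2) + c0 * w) = 0 := by
    linear_combination c0 * h - (x ^ 2 + y ^ 2 + 2 * u ^ 2 + 2 * v ^ 2) * ht
  exact even_even_base h'

/-- `q2(2a₀, 2a₁, 2b₀, 2b₁) = 4 q2(a₀, a₁, b₀, b₁)` -/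
lemma q2_two_mul (c0 c1 a0 a1 b0 b1 : ℤ) :
    q2 c0 c1 (2 * a0) (2 * a1) (2 * b0) (2 * b1) = 4 * q2 c0 c1 a0 a1 b0 b1 := by
  unfold q2; ring

/-- 2-adic descent for `q2` when `c₀` is odd and `c₁` even (`c₁ = 2c₁'`) -/
lemma descent2 (c0 c1' : ℤ) (hc : c0 % 2 = 1) (n : ℕ) :
    ∀ a0 a1 b0 b1 : ℤ, a0.natAbs + a1.natAbs + b0.natAbs + b1.natAbs ≤ n →
      q2 c0 (2 * c1') a0 a1 b0 b1 = 0 → a0 = 0 ∧ a1 = 0 ∧ b0 = 0 ∧ b1 = 0 := by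
  induction n with
  | zero =>
    intro a0 a1 b0 b1 hn _
    have h0 : a0.natAbs = 0 := by omega
    have h1 : a1.natAbs = 0 := by omega
    have h2 : b0.natAbs = 0 := by omega
    have h3 : b1.natAbs = 0 := by omega
    exact ⟨Int.natAbs_eq_zero.mp h0, Int.natAbs_eq_zero.mp h1, Int.natAbs_eq_zero.mp h2, Int.natAbs_eq_zero.mp h3⟩
  | succ n ih =>
    intro a0 a1 b0 b1 hn h
    have h1 : c0 * (a0 ^ 2 + b0 ^ 2) + 2 * c0 * (a1 ^ 2 + b1 ^ 2) + 8 * (c1' * (a0 * a1 + b0 * b1)) = 0 := by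
      unfold q2 at h; linarith
    obtain ⟨⟨a, rfl⟩, ⟨b, rfl⟩⟩ := even_even_of_eq hc h1
    have h2 : c0 * (a1 ^ 2 + b1 ^ 2) + 2 * c0 * (a ^ 2 + b ^ 2) + 8 * (c1' * (a * a1 + b * b1)) = 0 := by
      unfold q2 at h; linarith
    obtain ⟨⟨a', rfl⟩, ⟨b', rfl⟩⟩ := even_even_of_eq hc h2
    rw [q2_two_mul] at h
    have h' : q2 c0 (2 * c1') a a' b b' = 0 := by omega
    have hsize : a.natAbs + a'.natAbs + b.natAbs + b'.natAbs ≤ n := by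
      rw [Int.natAbs_mul, Int.natAbs_mul, Int.natAbs_mul, Int.natAbs_mul] at hn
      simp only [Int.reduceAbs] at hn
      omega
    obtain ⟨ha, ha', hb, hb'⟩ := ih a a' b b' hsize h'
    subst ha ha' hb hb'
    exact ⟨by ring, by ring, by ring, by ring⟩

/-- for `K = ℚ(ζ₈)`: if `c₀` is odd and `c₁` even, the norm space of `c = c₀ + c₁√2` has no non-zero integer zero -/
theorem anisotropic_two (c0 c1 : ℤ) (hc0 : c0 % 2 = 1) (hc1 : c1 % 2 = 0) (a0 a1 b0 b1 : ℤ)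
    (h : q2 c0 c1 a0 a1 b0 b1 = 0) : a0 = 0 ∧ a1 = 0 ∧ b0 = 0 ∧ b1 = 0 := by
  obtain ⟨c1', rfl⟩ := Int.dvd_of_emod_eq_zero hc1
  exact descent2 c0 c1' hc0 _ a0 a1 b0 b1 le_rfl h

/-- a representative of norm `−P` with `P ≡ 7 (mod 8)` (e.g. `P = p₁⋯p_r`, all `p_i ≡ 7 (mod 8)`, `r` odd) has `c₀` odd and `c₁` even -/
theorem norm_cond_two (c0 c1 P : ℤ) (hN : c0 ^ 2 - 2 * c1 ^ 2 = -P) (hP : P % 8 = 7) :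
    c0 % 2 = 1 ∧ c1 % 2 = 0 := by
  have h0 := sq_emod_eight c0
  have h1 := sq_emod_eight c1
  omega

/-- the first members as instances: `1 + 2√3` (`3 ∤ 1`) and `1 + 2√2` (`1` odd, `2` even) -/
theorem first_members : (1 : ℤ) % 3 ≠ 0 ∧ (1 : ℤ) % 2 = 1 ∧ (2 : ℤ) % 2 = 0 := by decide

end HodgeRepro0.AnisotropicResidualGeneral
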